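import Summits.BirchSwinnertonDyer.Rank1Residual.O5.O5FlatKummerNormalForm
import Summits.BirchSwinnertonDyer.BirchSwinnertonDyer.Theorems.Rank2ObservatoryTateDeepIstar
import Literature.NumberTheory.DiophantineGeometry.TateAlgorithmRingEquivProofs
import Literature.NumberTheory.DiophantineGeometry.ConductorRingOfIntegersProofs
import HarnessLib

/-!
# T30.5 `O5.FlexNormalForm.FlexNFCaseSKodairaLawThree` is a THEOREM: the flex normal form
# `y² + 3b·xy + 3ᵃA₃·y = x³` (`a ∈ {1, 2}`, `3 ∤ A₃`) has Kodaira type `IV` / `IV*` at `3`, with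
# `v₃(Δ_min)` and `f₃` as tabulated by `cellS` — by Tate's algorithm, run in the kernel
# (cell `b2b-bsdres`, team n1011, ROW T-FLEX-KOD; seat `b2b-bsdres-n1011-p18` GEN 13 under the idle
#  rule; skeleton `cells/n1011/skel/T-FLEX-KOD.md`; theorems only)

HONEST FRAMING (cell `b2b-bsdres`, run/shared/lean/b2b/bsd-rank1-residual/, verbatim in every file): the
goal of the cell is to DELETE the COMBINATION-SHAPED residual classes of the Birch–Swinnerton-Dyer formula
for ALL analytic-rank `≤ 1` elliptic curves over `ℚ` — "full BSD formula for every rank `≤ 1` curve in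
class `C`" assembled STRICTLY from published theorems — so that the rank-`≤ 1` remainder becomes exactly
the CONSTRUCTION-SHAPED classes, which are TYPED (missing-input `Prop`s), NOT attempted. This is not
"finishing BSD". Lane CLASS-CLOSURE / O5 (O5 OPEN): research route; census output (P-K19) is EVIDENCE,
never a Literature fact; nothing is booked; no mark of `RESIDUAL-MAP.md` moves. This file: THEOREMS ONLY
(no definition, no named fact, no `@[conjecture]` node, no `sorry`; net named-fact debt `0`); the O5
typer's node is proved EXACTLY as typed (its `def` imported by name, nothing of cc-typer-5's / o5-r1's
files edited); a `_holds` theorem for a conjecture node closes NO pair and moves NO mark.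

## What is proved

For `b A₃ : ℤ` with `3 ∤ A₃` and `a ∈ {1, 2}`, on the curve `nfQ b A₃ a = ⟨3b, 0, 3ᵃA₃, 0, 0⟩ / ℚ`
(o5-r1 GEN 13's flex normal form, T30; `P₀ = (0,0)` of order `3` singular modulo `3` = "Case S"):

* §1 `nfQ_eq_baseChange_nf` — the `ℚ`-model is the base change of the INTEGER model
  `nf (3b) (3ᵃA₃) : WeierstrassCurve ℤ`; the exact power of `3` in
  `Δ = 3^{3a+3}·A₃³·(b³ − 3ᵃA₃)`: `3⁶ ∥ Δ` / `3⁷ ∥ Δ` (`a = 1`, `3 ∤ b` / `3 ∣ b`) and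
  `3⁹ ∥ Δ` / `3¹¹ ∥ Δ` (`a = 2`), so the model is MINIMAL at `3` (`v₃Δ < 12`, *AEC* VII.1.1).
* §2 `kodairaSymbolAt_and_ordMinimalDiscriminant_nfQ_one` — `a = 1`: the model is Step-2 normalised
  (`3 ∣ a₃ = 3A₃`, `a₄ = a₆ = 0`, `3 ∣ b₂ = 9b²`), `9 ∣ a₆`, `27 ∣ b₈ = 0`, `27 ∤ b₆ = 9A₃²`: type
  **IV** (Silverman *ATAEC* IV.9.4 Steps 1–5; tree `TateAlgorithm.kodairaSymbolOfMinimal_eq_IV_of_step2`);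
  `kodairaSymbolAt_and_ordMinimalDiscriminant_nfQ_two` — `a = 2`: Step-8 normalised (`3 ∣ a₁`,
  `9 ∣ a₂, a₃`, `27 ∣ a₄`, `81 ∣ a₆`), quadratic `Y² + A₃Y` with two distinct roots (`3 ∤ A₃²`): type
  **IV*** (Step 8; tree `Rank2Observatory.Tate.kodairaSymbolOfMinimal_intCast_eq_IVstar`).  Both at the
  place `Additive.placeOf 3` of `ℤ`, with `ord₃ Δ_min` — through
  `kodairaSymbolAt_and_ordMinimalDiscriminant_placeOf_three_of_intModel` = the rank-2 observatory's
  integer-model plumbing `kodairaSymbolAt_and_ordMinimalDiscriminant_of_intModel` at the place of `𝓞 ℚ`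
  over `3` followed by the tree's `ℚ₃`-transfer (`kodairaSymbolAt_eq_padic`, `ordMinimalDiscriminant_eq_padic`;
  here `kodairaSymbolAt_eq_of_primesEquiv_eq'`, `ordMinimalDiscriminant_eq_of_primesEquiv_eq'`), stated
  for any integer model and any `u = 1` change so that the sequel rows (T31, T30.4) reuse it.
* §3 **`flexNFCaseSKodairaLawThree_holds : FlexNFCaseSKodairaLawThree`** — the node, binders verbatim;
  the `f₃` clause is Ogg's formula `f = v(Δ_min) + 1 − m`, which is both the tree's DEFINITION of
  `conductorExponent` and the typer's `oggF`.

Not claimed: the Tamagawa field `c = 3` and the Kummer fields of `cellS` (T30.6, `FlexNFCaseSKummerLawThree`);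
Case N (T30.4); the isogenous column (T31). No Galois-module statement.

References: J. H. Silverman, *Advanced Topics in the Arithmetic of Elliptic Curves*, GTM 151 (1994),
IV.9.4 Steps 1–8, Table 4.1, IV.11.1 [SilvermanATAEC1994]; J. H. Silverman, *The Arithmetic of Elliptic
Curves*, GTM 106 (2009), VII.1 Remark 1.1 [SilvermanAEC2009]; o5-r1 GEN 13 `T30-FLAT-KUMMER-NORMAL-FORM.md`
§1 (the hand proof), census P-K19 (kit j142073; EVIDENCE).
-/

open scoped NumberField

open IsDedekindDomain Rat.HeightOneSpectrum WeierstrassCurve NumberField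
  Literature.NumberTheory.EllipticCurves Literature.NumberTheory.DiophantineGeometry
  Literature.NumberTheory.DiophantineGeometry.TateAlgorithm
  Summit.BirchSwinnertonDyer.BirchSwinnertonDyer.Rank2Observatory.Tate
  Summit.BirchSwinnertonDyer.Rank1Residual

namespace Summit.BirchSwinnertonDyer.Rank1Residual.O5.FlexNormalForm

/-! ## §1 The integer model and the exact power of `3` in its discriminant -/

/-- The flex normal form over `ℚ` is the base change of the INTEGER model `nf (3b) (3ᵃA₃)`. [folklore] -/
theorem nfQ_eq_baseChange_nf (b A₃ : ℤ) (a : ℕ) :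
    nfQ b A₃ a = (nf (3 * b) (3 ^ a * A₃) : WeierstrassCurve ℤ).baseChange ℚ := by
  ext <;> simp [nfQ, nf, WeierstrassCurve.baseChange, WeierstrassCurve.map]

/-- `Δ(nf (3b) (3ᵃA₃)) = 3^{3a+3} · (A₃³ · (b³ − 3ᵃA₃))`. [folklore] -/
theorem nf_int_Δ (b A₃ : ℤ) (a : ℕ) :
    (nf (3 * b) (3 ^ a * A₃) : WeierstrassCurve ℤ).Δ = 3 ^ (3 * a + 3) * (A₃ ^ 3 * (b ^ 3 - 3 ^ a * A₃)) := by
  rw [nf_Δ]; ring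

/-- If `3 ∤ u` then `3ⁿ⁺¹ ∤ 3ⁿ·u`. [folklore] -/
private theorem not_pow_succ_dvd_pow_mul {u : ℤ} (n : ℕ) (hu : ¬ (3 : ℤ) ∣ u) :
    ¬ (3 : ℤ) ^ (n + 1) ∣ 3 ^ n * u := by
  rintro ⟨k, hk⟩
  refine hu ⟨k, ?_⟩
  have h3 : (3 : ℤ) ^ n ≠ 0 := pow_ne_zero _ (by norm_num)
  apply mul_left_cancel₀ h3
  rw [hk, pow_succ]; ring

/-- `3 ∤ A₃³ · (b³ − 3ᵃA₃)` when `3 ∤ A₃`, `3 ∤ b`, `1 ≤ a`. [folklore] -/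
private theorem not_three_dvd_unit_part {b A₃ : ℤ} {a : ℕ} (ha : 1 ≤ a) (hA : ¬ (3 : ℤ) ∣ A₃)
    (hb : ¬ (3 : ℤ) ∣ b) : ¬ (3 : ℤ) ∣ A₃ ^ 3 * (b ^ 3 - 3 ^ a * A₃) := by
  intro h
  rcases Int.prime_three.dvd_or_dvd h with h | h
  · exact hA (Int.prime_three.dvd_of_dvd_pow h)
  · have h3a : (3 : ℤ) ∣ 3 ^ a * A₃ := dvd_mul_of_dvd_left (dvd_pow_self 3 (by omega)) _
    have hb3 : (3 : ℤ) ∣ b ^ 3 := by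
      have := dvd_add h h3a
      simpa using this
    exact hb (Int.prime_three.dvd_of_dvd_pow hb3)

/-- `3 ∤ b`: `3^{3a+3} ∥ Δ`. [folklore] -/
theorem pow_dvd_Δ_of_not_dvd {b A₃ : ℤ} {a : ℕ} (ha : 1 ≤ a) (hA : ¬ (3 : ℤ) ∣ A₃) (hb : ¬ (3 : ℤ) ∣ b) :
    (3 : ℤ) ^ (3 * a + 3) ∣ (nf (3 * b) (3 ^ a * A₃) : WeierstrassCurve ℤ).Δ ∧
      ¬ (3 : ℤ) ^ (3 * a + 3 + 1) ∣ (nf (3 * b) (3 ^ a * A₃) : WeierstrassCurve ℤ).Δ := by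
  rw [nf_int_Δ]
  exact ⟨dvd_mul_right _ _, not_pow_succ_dvd_pow_mul _ (not_three_dvd_unit_part ha hA hb)⟩

/-- `3 ∣ b`, `b = 3c`: `b³ − 3ᵃA₃ = 3ᵃ · (3^{3−a} c³ − A₃)` for `a ≤ 3`, and `3 ∤ 3^{3−a}c³ − A₃` for `a < 3`;
so `3^{4a+3} ∥ Δ`. [folklore] -/
theorem pow_dvd_Δ_of_dvd {b A₃ : ℤ} {a : ℕ} (ha : 1 ≤ a) (ha3 : a < 3) (hA : ¬ (3 : ℤ) ∣ A₃)
    (hb : (3 : ℤ) ∣ b) :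
    (3 : ℤ) ^ (4 * a + 3) ∣ (nf (3 * b) (3 ^ a * A₃) : WeierstrassCurve ℤ).Δ ∧
      ¬ (3 : ℤ) ^ (4 * a + 3 + 1) ∣ (nf (3 * b) (3 ^ a * A₃) : WeierstrassCurve ℤ).Δ := by
  obtain ⟨c, rfl⟩ := hb
  have key : (nf (3 * (3 * c)) (3 ^ a * A₃) : WeierstrassCurve ℤ).Δ =
      3 ^ (4 * a + 3) * (A₃ ^ 3 * (3 ^ (3 - a) * c ^ 3 - A₃)) := by
    rw [nf_int_Δ]
    have h33 : (3 : ℤ) ^ 3 = 3 ^ a * 3 ^ (3 - a) := by rw [← pow_add]; congr 1; omega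
    have e1 : ((3 : ℤ) * c) ^ 3 - 3 ^ a * A₃ = 3 ^ a * (3 ^ (3 - a) * c ^ 3 - A₃) := by
      rw [mul_pow, h33]; ring
    rw [e1]; ring
  rw [key]
  refine ⟨dvd_mul_right _ _, not_pow_succ_dvd_pow_mul _ ?_⟩
  intro h
  rcases Int.prime_three.dvd_or_dvd h with h | h
  · exact hA (Int.prime_three.dvd_of_dvd_pow h)
  · have h3a : (3 : ℤ) ∣ 3 ^ (3 - a) * c ^ 3 := dvd_mul_of_dvd_left (dvd_pow_self 3 (by omega)) _
    have : (3 : ℤ) ∣ A₃ := by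
      have := dvd_sub h3a h
      simpa using this
    exact hA this

/-! ## §2 Tate's algorithm on the integer model at the place of `𝓞 ℚ` over `3`, read at `placeOf 3` -/

section Place

/-- The place of `𝓞 ℚ` over `3` used to run the rank-2 observatory's integer-model engine. [folklore] -/
theorem exists_place_three :
    ∃ v' : HeightOneSpectrum (𝓞 ℚ), primesEquiv (Additive.placeOf 3) = primesEquiv v' ∧
      natGenerator v' = 3 := by
  haveI : Fact (Nat.Prime 3) := ⟨Nat.prime_three⟩
  refine ⟨(primesEquiv (R := 𝓞 ℚ)).symm (primesEquiv (Additive.placeOf 3)),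
    by rw [Equiv.apply_symm_apply], ?_⟩
  show ((primesEquiv ((primesEquiv (R := 𝓞 ℚ)).symm (primesEquiv (Additive.placeOf 3))) : Nat.Primes) : ℕ) = 3
  rw [Equiv.apply_symm_apply]
  exact congrArg Subtype.val ((primesEquiv (R := ℤ)).apply_symm_apply ⟨3, Nat.prime_three⟩)

/-- The Kodaira symbol at places of two integer rings of `ℚ` over the same prime agree (both are the
`ℚ_p` computation, `kodairaSymbolAt_eq_padic`). [folklore] -/
theorem kodairaSymbolAt_eq_of_primesEquiv_eq' (W : WeierstrassCurve ℚ) [W.IsElliptic]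
    (v : HeightOneSpectrum ℤ) (v' : HeightOneSpectrum (𝓞 ℚ)) (h : primesEquiv v = primesEquiv v') :
    W.kodairaSymbolAt v = W.kodairaSymbolAt v' := by
  let e : Nat.Primes → KodairaSymbol := fun p =>
    haveI : Fact p.1.Prime := ⟨p.2⟩
    (W.baseChange ℚ_[p]).kodairaSymbol ℤ_[p]
  have h1 : W.kodairaSymbolAt v = e (primesEquiv v) := W.kodairaSymbolAt_eq_padic v
  have h2 : W.kodairaSymbolAt v' = e (primesEquiv v') := W.kodairaSymbolAt_eq_padic v'
  rw [h1, h2, h]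

/-- `ord Δ_min` at places of two integer rings of `ℚ` over the same prime agree
(`ordMinimalDiscriminant_eq_padic`). [folklore] -/
theorem ordMinimalDiscriminant_eq_of_primesEquiv_eq' (W : WeierstrassCurve ℚ)
    (v : HeightOneSpectrum ℤ) (v' : HeightOneSpectrum (𝓞 ℚ)) (h : primesEquiv v = primesEquiv v') :
    W.ordMinimalDiscriminant v = W.ordMinimalDiscriminant v' := by
  let e : Nat.Primes → ℕ := fun p =>
    haveI : Fact p.1.Prime := ⟨p.2⟩
    (IsDiscreteValuationRing.addVal ℤ_[p]
      (((W.baseChange ℚ_[p]).minimal ℤ_[p]).integralModel ℤ_[p]).Δ).toNat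
  have h1 : W.ordMinimalDiscriminant v = e (primesEquiv v) := W.ordMinimalDiscriminant_eq_padic v
  have h2 : W.ordMinimalDiscriminant v' = e (primesEquiv v') := W.ordMinimalDiscriminant_eq_padic v'
  rw [h1, h2, h]

end Place

/-- **The rank-2 observatory's integer-model engine, read at the place `Additive.placeOf 3` of `ℤ`.**
Let `M = D • W₀` be integer models with `D = (1, r, s, t)`, `M ⊗ ℚ` minimal at every place of `𝓞 ℚ`
over `3`, `3ⁿ ∥ Δ(M)`, and suppose Tate's algorithm returns `T` on the cast of `M` in every presentation
`3 = ϖε` of every such completion.  Then `W₀ ⊗ ℚ` has Kodaira type `T` and `ord₃ Δ_min = n` at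
`Additive.placeOf 3` (`kodairaSymbolAt_and_ordMinimalDiscriminant_of_intModel` at the place of `𝓞 ℚ` over
`3`, then the `ℚ₃`-transfer). [cite: SilvermanATAEC1994, IV.9.4] [cite: SilvermanAEC2009, VII.1 Prop. 1.3(b)] -/
theorem kodairaSymbolAt_and_ordMinimalDiscriminant_placeOf_three_of_intModel (W₀ M : WeierstrassCurve ℤ)
    (D : VariableChange ℤ) (hD : D.u = 1) (hM : M = D • W₀)
    (hmin : ∀ v' : HeightOneSpectrum (𝓞 ℚ), natGenerator v' = 3 → (M.baseChange ℚ).IsMinimalAt v')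
    {n : ℕ} (hΔ : (3 : ℤ) ^ n ∣ M.Δ) (hΔ' : ¬ (3 : ℤ) ^ (n + 1) ∣ M.Δ) {T : KodairaSymbol}
    (hT : ∀ (v' : HeightOneSpectrum (𝓞 ℚ)) (ε : v'.adicCompletionIntegers ℚ), IsUnit ε →
      ((3 : ℕ) : v'.adicCompletionIntegers ℚ) = uniformizer (v'.adicCompletionIntegers ℚ) * ε →
      (M.map (Int.castRingHom (v'.adicCompletionIntegers ℚ))).kodairaSymbolOfMinimal = T) :
    (W₀.baseChange ℚ).kodairaSymbolAt (Additive.placeOf 3) = T ∧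
      (W₀.baseChange ℚ).ordMinimalDiscriminant (Additive.placeOf 3) = n := by
  obtain ⟨v', hvv', hv'⟩ := exists_place_three
  obtain ⟨hK, hord⟩ := kodairaSymbolAt_and_ordMinimalDiscriminant_of_intModel v' hv' W₀ M D hD hM
    (hmin v' hv') (by exact_mod_cast hΔ) (by exact_mod_cast hΔ') (fun ε hε hpε ↦ hT v' ε hε hpε)
  -- `W₀ ⊗ ℚ` is elliptic (its discriminant is the non-zero integer `Δ(M)`)
  have hΔM0 : M.Δ ≠ 0 := by rintro h0; rw [h0] at hΔ'; exact hΔ' (dvd_zero _)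
  have hΔW : M.Δ = W₀.Δ := by rw [hM, variableChange_Δ, hD]; simp
  haveI : (W₀.baseChange ℚ).IsElliptic := by
    refine ⟨(show (W₀.baseChange ℚ).Δ ≠ 0 from ?_).isUnit⟩
    rw [(Step2Cert.baseChange_eqs W₀).2.2.2.2.2.2.2.2, Int.cast_ne_zero, ← hΔW]; exact hΔM0
  rw [kodairaSymbolAt_eq_of_primesEquiv_eq' _ _ v' hvv', ordMinimalDiscriminant_eq_of_primesEquiv_eq' _ _ v' hvv']
  exact ⟨hK, hord⟩

/-- **The engine call**: if `3ⁿ ∥ Δ(nf (3b) (3ᵃA₃))` with `n < 12` and Tate's algorithm returns `T` on the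
cast of the integer model in every presentation `3 = ϖε` of every complete DVR `O_v` (`v ∣ 3` a place of
`𝓞 ℚ`), then `nfQ b A₃ a` has Kodaira type `T` and `ord₃ Δ_min = n` at `Additive.placeOf 3`.
[cite: SilvermanATAEC1994, IV.9.4] [cite: SilvermanAEC2009, VII.1 Remark 1.1] -/
theorem kodairaSymbolAt_and_ordMinimalDiscriminant_nfQ_of_intModel (b A₃ : ℤ) (a : ℕ) {n : ℕ}
    (hn : n < 12) (hΔ : (3 : ℤ) ^ n ∣ (nf (3 * b) (3 ^ a * A₃) : WeierstrassCurve ℤ).Δ)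
    (hΔ' : ¬ (3 : ℤ) ^ (n + 1) ∣ (nf (3 * b) (3 ^ a * A₃) : WeierstrassCurve ℤ).Δ) {T : KodairaSymbol}
    (hT : ∀ (v' : HeightOneSpectrum (𝓞 ℚ)) (ε : v'.adicCompletionIntegers ℚ), IsUnit ε →
      ((3 : ℕ) : v'.adicCompletionIntegers ℚ) = uniformizer (v'.adicCompletionIntegers ℚ) * ε →
      ((nf (3 * b) (3 ^ a * A₃) : WeierstrassCurve ℤ).map
        (Int.castRingHom (v'.adicCompletionIntegers ℚ))).kodairaSymbolOfMinimal = T) :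
    (nfQ b A₃ a).kodairaSymbolAt (Additive.placeOf 3) = T ∧
      (nfQ b A₃ a).ordMinimalDiscriminant (Additive.placeOf 3) = n := by
  rw [nfQ_eq_baseChange_nf]
  exact kodairaSymbolAt_and_ordMinimalDiscriminant_placeOf_three_of_intModel _ _ 1 rfl (one_smul _ _).symm
    (fun v' hv' ↦ isMinimalAt_of_criterion v' hv' _ (by exact_mod_cast hΔ) (by exact_mod_cast hΔ') (Or.inl hn))
    hΔ hΔ' hT

/-- **Case S, `a = 1`: Kodaira type `IV` at `3`, `ord₃ Δ_min = 7` if `3 ∣ b`, else `6`** (Steps 1–5 of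
Tate's algorithm on `⟨3b, 0, 3A₃, 0, 0⟩`: `27 ∤ b₆ = 9A₃²`). [cite: SilvermanATAEC1994, IV.9.4 Steps 1–5] -/
theorem kodairaSymbolAt_and_ordMinimalDiscriminant_nfQ_one (b A₃ : ℤ) (hA : ¬ (3 : ℤ) ∣ A₃) :
    (nfQ b A₃ 1).kodairaSymbolAt (Additive.placeOf 3) = .IV ∧
      (nfQ b A₃ 1).ordMinimalDiscriminant (Additive.placeOf 3) = (if (3 : ℤ) ∣ b then 7 else 6) := by
  -- the exact power of `3` in `Δ`
  have hΔpair : (3 : ℤ) ^ (if (3 : ℤ) ∣ b then 7 else 6) ∣ (nf (3 * b) (3 ^ 1 * A₃) : WeierstrassCurve ℤ).Δ ∧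
      ¬ (3 : ℤ) ^ ((if (3 : ℤ) ∣ b then 7 else 6) + 1) ∣ (nf (3 * b) (3 ^ 1 * A₃) : WeierstrassCurve ℤ).Δ := by
    by_cases hb : (3 : ℤ) ∣ b
    · rw [if_pos hb]; exact pow_dvd_Δ_of_dvd le_rfl (by norm_num) hA hb
    · rw [if_neg hb]; exact pow_dvd_Δ_of_not_dvd le_rfl hA hb
  refine kodairaSymbolAt_and_ordMinimalDiscriminant_nfQ_of_intModel b A₃ 1 (by split_ifs <;> norm_num)
    hΔpair.1 hΔpair.2 ?_
  intro v' ε hε hpε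
  haveI := perfectField_residueField_adicCompletionIntegers (K := ℚ) v'
  set R := v'.adicCompletionIntegers ℚ
  obtain ⟨e1, e2, e3, e4, e6, eΔ⟩ := map_intCast_eqs (R := R) (nf (3 * b) (3 ^ 1 * A₃) : WeierstrassCurve ℤ)
  have hp : Nat.Prime 3 := Nat.prime_three
  refine kodairaSymbolOfMinimal_eq_IV_of_step2 ?_ ?_ ?_ ?_ ?_ ?_ ?_ ?_
  · -- `ϖ ∣ Δ`
    rw [eΔ]; exact uniformizer_dvd_intCast hpε ((pow_dvd_pow (3 : ℤ) (by split_ifs <;> norm_num)).trans hΔpair.1)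
  · -- `ϖ ∣ a₃ = 3A₃`
    rw [e3]; exact uniformizer_dvd_intCast hpε ⟨A₃, by simp [nf]⟩
  · rw [e4]; simp [nf]
  · rw [e6]; simp [nf]
  · -- `ϖ ∣ b₂ = 9b²`
    rw [WeierstrassCurve.map_b₂, nf_b₂, eq_intCast]
    exact uniformizer_dvd_intCast hpε ⟨3 * b ^ 2, by ring⟩
  · rw [e6]; simp [nf]
  · rw [WeierstrassCurve.map_b₈, nf_b₈, map_zero]; exact dvd_zero _
  · -- `ϖ³ ∤ b₆ = 9A₃²`
    rw [WeierstrassCurve.map_b₆, nf_b₆, eq_intCast]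
    refine not_pow_succ_dvd_intCast hp hε hpε (n := 2) ⟨A₃ ^ 2, by ring⟩ ?_
    have : ((3 : ℕ) : ℤ) ^ (2 + 1) = 3 ^ 2 * 3 := by norm_num
    rw [this, show ((3 : ℤ) ^ 1 * A₃) ^ 2 = 3 ^ 2 * A₃ ^ 2 by ring]
    intro h
    have h' : (3 : ℤ) ∣ A₃ ^ 2 := (mul_dvd_mul_iff_left (by norm_num : (3 : ℤ) ^ 2 ≠ 0)).mp h
    exact hA (Int.prime_three.dvd_of_dvd_pow h')

/-- **Case S, `a = 2`: Kodaira type `IV*` at `3`, `ord₃ Δ_min = 11` if `3 ∣ b`, else `9`** (Step 8 of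
Tate's algorithm on `⟨3b, 0, 9A₃, 0, 0⟩`: the quadratic `Y² + A₃Y` has two distinct roots as `3 ∤ A₃`).
[cite: SilvermanATAEC1994, IV.9.4 Step 8] -/
theorem kodairaSymbolAt_and_ordMinimalDiscriminant_nfQ_two (b A₃ : ℤ) (hA : ¬ (3 : ℤ) ∣ A₃) :
    (nfQ b A₃ 2).kodairaSymbolAt (Additive.placeOf 3) = .IVstar ∧
      (nfQ b A₃ 2).ordMinimalDiscriminant (Additive.placeOf 3) = (if (3 : ℤ) ∣ b then 11 else 9) := by
  have hΔpair : (3 : ℤ) ^ (if (3 : ℤ) ∣ b then 11 else 9) ∣ (nf (3 * b) (3 ^ 2 * A₃) : WeierstrassCurve ℤ).Δ ∧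
      ¬ (3 : ℤ) ^ ((if (3 : ℤ) ∣ b then 11 else 9) + 1) ∣ (nf (3 * b) (3 ^ 2 * A₃) : WeierstrassCurve ℤ).Δ := by
    by_cases hb : (3 : ℤ) ∣ b
    · rw [if_pos hb]; exact pow_dvd_Δ_of_dvd (by norm_num) (by norm_num) hA hb
    · rw [if_neg hb]; exact pow_dvd_Δ_of_not_dvd (by norm_num) hA hb
  refine kodairaSymbolAt_and_ordMinimalDiscriminant_nfQ_of_intModel b A₃ 2 (by split_ifs <;> norm_num)
    hΔpair.1 hΔpair.2 ?_
  intro v' ε hε hpε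
  haveI := perfectField_residueField_adicCompletionIntegers (K := ℚ) v'
  have hp : Nat.Prime 3 := Nat.prime_three
  refine kodairaSymbolOfMinimal_intCast_eq_IVstar hp hε hpε ?_ ?_ ?_ ?_ ?_ ?_
  · exact ⟨b, by simp [nf]⟩
  · simp [nf]
  · exact ⟨A₃, by simp [nf]⟩
  · simp [nf]
  · simp [nf]
  · -- `3 ∤ (9A₃/9)² + 4·0 = A₃²`
    have e3 : (nf (3 * b) (3 ^ 2 * A₃) : WeierstrassCurve ℤ).a₃ / ((3 : ℕ) : ℤ) ^ 2 = A₃ := by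
      simp [nf]
    have e6 : (nf (3 * b) (3 ^ 2 * A₃) : WeierstrassCurve ℤ).a₆ / ((3 : ℕ) : ℤ) ^ 4 = 0 := by simp [nf]
    rw [e3, e6, mul_zero, add_zero, pow_one]
    intro h
    exact hA (Int.prime_three.dvd_of_dvd_pow (by exact_mod_cast h))

/-! ## §3 The node T30.5, as typed -/

/-- **T30.5 `FlexNFCaseSKodairaLawThree` holds** (o5-r1 GEN 13; cc-typer-5 A-O5-28): for `a ∈ {1, 2}` and
`3 ∤ A₃`, the flex normal form `y² + 3b·xy + 3ᵃA₃·y = x³` has at `3` the Kodaira symbol and the conductor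
exponent computed by `cellS a b` — `IV`, `f₃ = v₃Δ − 2 ∈ {4, 5}` (`a = 1`); `IV*`, `f₃ = v₃Δ − 6 ∈ {3, 5}`
(`a = 2`).  Tate's algorithm at `3` (§2) + Ogg's formula, which is the tree's definition of
`conductorExponent` and the typer's `oggF`.  The node keeps its `@[conjecture]` tag in the typer's file
(the lane's restamp to make); census P-K19 (20 396 Case-S rows, 0 exceptions) stays EVIDENCE.
[cite: SilvermanATAEC1994, IV.9.4 Steps 1–8 and IV.11.1] -/
theorem flexNFCaseSKodairaLawThree_holds : FlexNFCaseSKodairaLawThree := by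
  intro a b A₃ ha hA
  have hb3 : (b % 3 = 0) ↔ (3 : ℤ) ∣ b := (Int.dvd_iff_emod_eq_zero ..).symm
  rcases ha with rfl | rfl
  · obtain ⟨hK, hord⟩ := kodairaSymbolAt_and_ordMinimalDiscriminant_nfQ_one b A₃ hA
    refine ⟨?_, ?_⟩
    · rw [hK]; simp [cellS]
    · unfold WeierstrassCurve.conductorExponent WeierstrassCurve.numComponentsAt
      rw [hK, hord]
      by_cases hb : (3 : ℤ) ∣ b
      · rw [if_pos hb]; simp [cellS, oggF, hb3.mpr hb, KodairaSymbol.numComponents]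
      · have hb' : ¬ b % 3 = 0 := fun h ↦ hb (hb3.mp h)
        rw [if_neg hb]; simp [cellS, oggF, hb', KodairaSymbol.numComponents]
  · obtain ⟨hK, hord⟩ := kodairaSymbolAt_and_ordMinimalDiscriminant_nfQ_two b A₃ hA
    refine ⟨?_, ?_⟩
    · rw [hK]; simp [cellS]
    · unfold WeierstrassCurve.conductorExponent WeierstrassCurve.numComponentsAt
      rw [hK, hord]
      by_cases hb : (3 : ℤ) ∣ b
      · rw [if_pos hb]; simp [cellS, oggF, hb3.mpr hb, KodairaSymbol.numComponents]
      · have hb' : ¬ b % 3 = 0 := fun h ↦ hb (hb3.mp h)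
        rw [if_neg hb]; simp [cellS, oggF, hb', KodairaSymbol.numComponents]

end Summit.BirchSwinnertonDyer.Rank1Residual.O5.FlexNormalForm
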